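import Summits.AtomisticToContinuum.FouriersLaw.Theorems.CoercivePulseLinearCeilingIffAbelCeiling
import Summits.AtomisticToContinuum.FouriersLaw.Theorems.HoelderEscapeProfileFibreCalculus
import HarnessLib

/-!
# `CoercivePulse.LinearCeiling` ⇔ `HoelderEscapeProfile.AbelSpreadCeiling` (items stmt-15383 ⇔ stmt-16010)

Line `SpikeLemma` of crux `CoercivePulse.LinearCeiling` (item stmt-AtomisticToContinuum-15383), lead c2, 2026-08-18:
the THIRD de-duplication of the crux over landed theorems only (after `linearCeiling_iff_abelCeiling`, p172207, and
`linearCeiling_iff_heatVarianceCeiling`, p172660). The crux of the sibling route `HoelderEscapeProfile`,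

  `AbelSpreadCeiling` (item stmt-AtomisticToContinuum-16010): for every guarded pair `(μ, D)` of the pinned anharmonic
  chain, the second moment of the Abel profile `S̄_ν(x) = ν∫₀^∞ e^{−νt} S(x,t) dt` of the averaged energy pulse obeys
  `Σ_x x² S̄_ν(x) ≤ B/ν` for `0 < ν ≤ ν₀`,

is EQUIVALENT to `LinearCeiling`, both being equivalent to the infinite-volume Abel ceiling

  (AC) `∃ B ν₀ > 0, ∀ ν ∈ (0, ν₀), ∫₀^∞ e^{−νt} C_T(t) dt ≤ B` for every guarded pair.

The bridge is clause (12) of the PROVED item `HoelderEscapeProfile.FibreCalculus` (stmt-16011, `fibreCalculus_proof`),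
Helfand's identity in Abel form `∫₀^∞ e^{−νt} C_T = (ν/2)·(Σ_x x² S̄_ν(x) − Σ_x x² S(x,0))`, together with its clauses
(3)–(4) (the integrability / summability guards of `AbelSpreadCeiling` hold for every guarded pair) and the derivable
a.e. shift-covariance (`Negative.shiftCovariant_of_preservesMeasure`).

Consequence for planners: items stmt-15383 (`CoercivePulse.LinearCeiling`), stmt-15770
(`CageBudgetFekete.HeatVarianceCeiling`) and stmt-16010 (`HoelderEscapeProfile.AbelSpreadCeiling`) are ONE open
statement — the finiteness half of the conductivity of the infinite pinned anharmonic chain in Abelian `limsup` form.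

[cite: Helfand1960, §II] [cite: BonettoLebowitzReyBellet2000, §7 eq. (37)]
-/

noncomputable section

namespace Summit.AtomisticToContinuum.FouriersLaw.Theorems.LinearCeiling.SpikeLemma

open MeasureTheory Filter Set
open scoped Topology BigOperators
open Literature.MathematicalPhysics.KineticTheory.HeatConduction
open Summit.AtomisticToContinuum.FouriersLaw.Theses.CoercivePulse (LinearCeiling)
open Summit.AtomisticToContinuum.FouriersLaw.Theses.HoelderEscapeProfile (AbelSpreadCeiling)

/-- **(AC) ⇒ `AbelSpreadCeiling`.** If the Abel means of the summed current autocorrelation of every guarded pair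
are bounded above on some `(0, ν₀)`, then the second moment of the Abel profile of the averaged energy pulse obeys
`Σ_x x² S̄_ν(x) ≤ B'/ν` for `0 < ν ≤ ν₀'`: Helfand's identity in Abel form (clause (12) of the proved
`HoelderEscapeProfile.FibreCalculus`) reads `Σ_x x² S̄_ν(x) = M(0) + (2/ν)∫₀^∞ e^{−νt} C_T`.
[cite: Helfand1960, §II] -/
theorem abelSpreadCeiling_of_abelCeiling
    (hAC : ∀ ω₂ lam β γ : ℝ, 0 < ω₂ → 0 < lam → 0 < β → ∀ T : ℝ, 0 < T →
      ∀ μ : MeasureTheory.Measure ChainConfig, (pinnedChain ω₂ lam β γ).IsChainGibbsMeasure T μ →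
      IsShiftInvariant μ → μ.map (fun σ : ChainConfig => fun x : ℤ => ((σ x).1, -(σ x).2)) = μ →
      ∀ D : InfiniteChainDynamics (pinnedChain ω₂ lam β γ), D.PreservesMeasure μ →
      ∃ B ν₀ : ℝ, 0 < ν₀ ∧ ∀ ν : ℝ, 0 < ν → ν < ν₀ →
        ∫ t in Set.Ioi (0:ℝ), Real.exp (-(ν * t)) * D.currentCorrelation μ t ≤ B) :
    AbelSpreadCeiling := by
  intro ω₂ lam β γ hω hl hβ T hT μ hG hSI hR D hP hSh h hh S hS Sb hSb _hInt _hSum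
  -- Helfand–Abel = clause (12) of the PROVED route item FibreCalculus (stmt-AtomisticToContinuum-16011)
  obtain ⟨-, -, -, -, -, -, -, -, -, -, -, hHelf⟩ :=
    Summit.AtomisticToContinuum.FouriersLaw.Theorems.FibreCalculusSketch.fibreCalculus_proof ω₂ lam β γ hω hl hβ T hT
      μ hG hSI hR D hP hSh h hh S hS Sb hSb _ rfl _ rfl _ rfl _ rfl
  obtain ⟨B, ν₀, hν₀, hA⟩ := hAC ω₂ lam β γ hω hl hβ T hT μ hG hSI hR D hP
  set M₀ : ℝ := ∑' x : ℤ, (x : ℝ) ^ 2 * S x 0 with hM₀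
  have hν₁ : 0 < ν₀ / 2 := by positivity
  refine ⟨2 * |B| + |M₀|, min (ν₀ / 2) 1, lt_min hν₁ one_pos, fun ν hν hνle => ?_⟩
  have hν1 : ν ≤ 1 := hνle.trans (min_le_right _ _)
  have hνlt : ν < ν₀ := lt_of_le_of_lt (hνle.trans (min_le_left _ _)) (by linarith)
  have hb := hA ν hν hνlt
  rw [hHelf ν hν] at hb
  -- `ν/2 · (Σ x² S̄_ν − M₀) ≤ B ≤ |B|`
  have hb' : ν / 2 * ((∑' x : ℤ, (x : ℝ) ^ 2 * Sb ν x) - M₀) ≤ |B| := hb.trans (le_abs_self B)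
  have hMν : (∑' x : ℤ, (x : ℝ) ^ 2 * Sb ν x) ≤ 2 * |B| / ν + M₀ := by
    have e2 : (∑' x : ℤ, (x : ℝ) ^ 2 * Sb ν x) - M₀ ≤ 2 * |B| / ν := by
      rw [le_div_iff₀ hν]; nlinarith
    linarith
  have hM₀ν : M₀ ≤ |M₀| / ν := by
    rw [le_div_iff₀ hν]
    have := le_abs_self M₀
    nlinarith [abs_nonneg M₀]
  calc (∑' x : ℤ, (x : ℝ) ^ 2 * Sb ν x) ≤ 2 * |B| / ν + M₀ := hMν
    _ ≤ 2 * |B| / ν + |M₀| / ν := by linarith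
    _ = (2 * |B| + |M₀|) / ν := by ring

/-- **`AbelSpreadCeiling` ⇒ (AC).** If the second moment of the Abel profile of the averaged energy pulse of every
guarded pair obeys `Σ_x x² S̄_ν(x) ≤ B/ν` (`0 < ν ≤ ν₀`), then the Abel means of the summed current autocorrelation of
every guarded pair are bounded above on `(0, min ν₀ 1)`: the guards of `AbelSpreadCeiling` (integrability of
`e^{−νt}S(x,·)`, summability of `(1+x²)|S̄_ν|`) are clauses (3)–(4) of the proved `HoelderEscapeProfile.FibreCalculus`,
its clause (12) is Helfand's identity in Abel form, and a.e. shift-covariance is derivable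
(`Negative.shiftCovariant_of_preservesMeasure`). [cite: Helfand1960, §II] -/
theorem abelCeiling_of_abelSpreadCeiling (hASC : AbelSpreadCeiling) :
    ∀ ω₂ lam β γ : ℝ, 0 < ω₂ → 0 < lam → 0 < β → ∀ T : ℝ, 0 < T →
      ∀ μ : MeasureTheory.Measure ChainConfig, (pinnedChain ω₂ lam β γ).IsChainGibbsMeasure T μ →
      IsShiftInvariant μ → μ.map (fun σ : ChainConfig => fun x : ℤ => ((σ x).1, -(σ x).2)) = μ →
      ∀ D : InfiniteChainDynamics (pinnedChain ω₂ lam β γ), D.PreservesMeasure μ →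
      ∃ B ν₀ : ℝ, 0 < ν₀ ∧ ∀ ν : ℝ, 0 < ν → ν < ν₀ →
        ∫ t in Set.Ioi (0:ℝ), Real.exp (-(ν * t)) * D.currentCorrelation μ t ≤ B := by
  intro ω₂ lam β γ hω hl hβ T hT μ hG hSI hR D hP
  have hSh : ∀ t : ℝ, ∀ᵐ σ ∂μ, D.flow t (shift σ) = shift (D.flow t σ) := fun t =>
    Summit.AtomisticToContinuum.FouriersLaw.Theorems.LinearCeiling.Negative.shiftCovariant_of_preservesMeasure
      hω hl hβ hT hG hSI D hP t
  -- the pulse objects, generalised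
  obtain ⟨h, hh⟩ : ∃ h : ChainConfig → ℤ → ℝ, h = (fun (σ : ChainConfig) (x : ℤ) => (σ x).2 ^ 2 / 2 +
      (pinnedChain ω₂ lam β γ).U (σ x).1 + ((pinnedChain ω₂ lam β γ).V ((σ (x + 1)).1 - (σ x).1) +
      (pinnedChain ω₂ lam β γ).V ((σ x).1 - (σ (x - 1)).1)) / 2) := ⟨_, rfl⟩
  obtain ⟨S, hS⟩ : ∃ S : ℤ → ℝ → ℝ, S = (fun (x : ℤ) (t : ℝ) =>
      ∫ σ, (h σ 0 - ∫ σ', h σ' 0 ∂μ) * (h (D.flow t σ) x - ∫ σ', h σ' 0 ∂μ) ∂μ) := ⟨_, rfl⟩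
  obtain ⟨Sb, hSb⟩ : ∃ Sb : ℝ → ℤ → ℝ, Sb = (fun (ν : ℝ) (x : ℤ) =>
      ν * ∫ t in Set.Ioi (0:ℝ), Real.exp (-(ν * t)) * S x t) := ⟨_, rfl⟩
  obtain ⟨-, -, hInt, hSum, -, -, -, -, -, -, -, hHelf⟩ :=
    Summit.AtomisticToContinuum.FouriersLaw.Theorems.FibreCalculusSketch.fibreCalculus_proof ω₂ lam β γ hω hl hβ T hT
      μ hG hSI hR D hP hSh h hh S hS Sb hSb _ rfl _ rfl _ rfl _ rfl
  obtain ⟨B, ν₀, hν₀, hB⟩ := hASC ω₂ lam β γ hω hl hβ T hT μ hG hSI hR D hP hSh h hh S hS Sb hSb hInt hSum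
  set M₀ : ℝ := ∑' x : ℤ, (x : ℝ) ^ 2 * S x 0 with hM₀
  refine ⟨|B| / 2 + |M₀| / 2, min ν₀ 1, lt_min hν₀ one_pos, fun ν hν hνlt => ?_⟩
  have hν1 : ν ≤ 1 := (hνlt.le).trans (min_le_right _ _)
  have hνle : ν ≤ ν₀ := (hνlt.le).trans (min_le_left _ _)
  have hb := hB ν hν hνle
  rw [hHelf ν hν]
  -- `Σ x² S̄_ν ≤ B/ν ≤ |B|/ν`, so `ν/2 (Σ − M₀) ≤ |B|/2 − ν M₀/2 ≤ |B|/2 + |M₀|/2`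
  have hb' : (∑' x : ℤ, (x : ℝ) ^ 2 * Sb ν x) ≤ |B| / ν :=
    hb.trans (div_le_div_of_nonneg_right (le_abs_self B) hν.le)
  have h1 : ν / 2 * ((∑' x : ℤ, (x : ℝ) ^ 2 * Sb ν x) - M₀) ≤ ν / 2 * (|B| / ν - M₀) :=
    mul_le_mul_of_nonneg_left (by linarith) (by positivity)
  have h2 : ν / 2 * (|B| / ν - M₀) = |B| / 2 - ν * M₀ / 2 := by
    field_simp
  have h3 : -(ν * M₀) ≤ |M₀| := by
    have := neg_abs_le M₀
    rcases le_or_gt 0 M₀ with hM | hM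
    · nlinarith [abs_nonneg M₀]
    · have hA : |M₀| = -M₀ := abs_of_neg hM
      nlinarith
  linarith [h1, h2.le, h2.ge]

/-- **`LinearCeiling` ⇔ `AbelSpreadCeiling`** — the cruxes stmt-AtomisticToContinuum-15383 (route `CoercivePulse`) and
stmt-AtomisticToContinuum-16010 (route `HoelderEscapeProfile`) are the same statement over landed theorems: both are
the infinite-volume Abel ceiling (AC) of the summed current autocorrelation of the guarded pairs
(`linearCeiling_iff_abelCeiling` + Helfand's identity in Abel form from the proved `FibreCalculus`).
[cite: Helfand1960, §II] -/
theorem linearCeiling_iff_abelSpreadCeiling : LinearCeiling ↔ AbelSpreadCeiling :=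
  linearCeiling_iff_abelCeiling.trans ⟨abelSpreadCeiling_of_abelCeiling, abelCeiling_of_abelSpreadCeiling⟩

/-- **`AbelSpreadCeiling` ⇒ `LinearCeiling`** (close-on-close certificate: closing stmt-16010 closes stmt-15383). -/
theorem linearCeiling_of_abelSpreadCeiling (hASC : AbelSpreadCeiling) : LinearCeiling :=
  linearCeiling_iff_abelSpreadCeiling.2 hASC

/-- **`LinearCeiling` ⇒ `AbelSpreadCeiling`** (close-on-close certificate: closing stmt-15383 closes stmt-16010). -/
theorem abelSpreadCeiling_of_linearCeiling (hLC : LinearCeiling) : AbelSpreadCeiling :=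
  linearCeiling_iff_abelSpreadCeiling.1 hLC

end Summit.AtomisticToContinuum.FouriersLaw.Theorems.LinearCeiling.SpikeLemma

end
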